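import Mathlib.RingTheory.FiniteLength
import Mathlib.RingTheory.Artinian.Module
import Mathlib.RingTheory.SimpleModule.Basic
import Literature.NumberTheory.Automorphic.SmoothProjector
import Literature.NumberTheory.Automorphic.ParabolicInductionQuotientProofs
import Literature.NumberTheory.Automorphic.PAdicRepsJacquetAdmissibilityProofs
import Literature.RepresentationTheory.Semisimple.SubrepresentationEquiv
import HarnessLib

/-!
# Sub- and quotient representations of smooth and admissible representations; finite length

Generic representation theory (no `GL_n`) used in the reduction of "parabolic induction
preserves finite length" (`Representation.isFiniteLength_parabolicIndGL`, Zelevinsky 1980,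
Prop. 1.4; Bernstein–Zelevinsky 1977, Thm. 2.8) to the case of an irreducible inducing
representation ("since the functors are exact it suffices to treat irreducible `ω`",
Zelevinsky 1980, §1.4):

* intertwining maps preserve smooth vectors (`Representation.IsSmoothVector.map`); subrepresentations
  of smooth / admissible representations are smooth / admissible
  (`Representation.IsSmooth.toRepresentation`, `Representation.IsAdmissible.toRepresentation`);
* **naturality of the averaging projector** `e_K` of `SmoothProjector` under intertwining maps
  (`Representation.map_avg`), whence `K`-fixed vectors of a quotient lift
  (`Representation.fixedPoints_le_map_of_surjective`: `W^K = T(V^K)` for a surjective `G`-map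
  `T : V → W`, `V` smooth, `K` compact) and **quotients of admissible representations are
  admissible** (`Representation.IsAdmissible.of_surjective`, `Representation.IsAdmissible.quotientRep`)
  — Bernstein–Zelevinsky 1976, §2.1–2.3; Casselman 1995, §2.1 ("`V ↦ V^K` is exact");
* the `k[G]`-module dictionary for exact sequences: for intertwining maps `f : ρ → σ`, `g : σ → τ`
  with `range f = ker g`, finite length of `ρ.asModule` and `τ.asModule` gives finite length of
  `σ.asModule` (`Representation.isFiniteLength_of_range_eq_ker`), the special cases of an
  injection / a subrepresentation with its quotient, and irreducibility of the quotient by `N` when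
  `ρ.asModule ⧸ N` is a simple `k[G]`-module (`Subrepresentation.isIrreducible_quotientRep_of_isSimpleModule`).

Everything is standard (Bernstein–Zelevinsky 1976, §2; Bushnell–Henniart 2006, §§1–2) and tagged
folklore; theorems only, one new definition (`Representation.quotientRepAsModuleEquiv`), no named
facts. The inclusion of a subrepresentation is the tree's
`Literature.RepresentationTheory.FiniteGroups.Subrepresentation.subtypeIntertwiningMap` (with
`Literature.RepresentationTheory.Semisimple.Subrepresentation.subtypeIntertwiningMap_injective`),
not redefined.
Declarations in `namespace Representation` / `Subrepresentation` are deliberate dot-notation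
extensions of the Mathlib namespaces, as in the sibling files (`SmoothRepresentation`,
`ParabolicInductionQuotientProofs`).

## References

* I. N. Bernstein, A. V. Zelevinsky, *Representations of the group `GL(n, F)` where `F` is a
  non-archimedean local field*, Russian Math. Surveys 31:3 (1976), §2.1–2.3.
* A. V. Zelevinsky, *Induced representations of reductive `p`-adic groups II*, Ann. Sci. ÉNS 13
  (1980), §1.4.
* W. Casselman, *Introduction to the theory of admissible representations of `p`-adic reductive
  groups* (1995 notes), §2.1.
-/

noncomputable section

open scoped MonoidAlgebra

namespace Representation

/-! ### Smooth vectors, subrepresentations and intertwining maps -/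

section Smooth

variable {k G V W : Type*} [CommRing k] [Group G]
  [AddCommGroup V] [Module k V] [AddCommGroup W] [Module k W]
  {ρ : Representation k G V} {τ : Representation k G W}

/-- The stabiliser of `T v` contains the stabiliser of `v` for an intertwining map `T`. [folklore] -/
theorem stabilizerSubgroup_le_stabilizerSubgroup_map (T : ρ.IntertwiningMap τ) (v : V) :
    ρ.stabilizerSubgroup v ≤ τ.stabilizerSubgroup (T v) := by
  intro g hg
  rw [mem_stabilizerSubgroup] at hg ⊢
  rw [← T.isIntertwining, hg]

/-- The stabiliser of a vector of a subrepresentation is its stabiliser in the ambient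
representation. [folklore] -/
theorem stabilizerSubgroup_toRepresentation (N : Subrepresentation ρ) (v : N.toSubmodule) :
    N.toRepresentation.stabilizerSubgroup v = ρ.stabilizerSubgroup (v : V) := by
  ext g
  simp only [mem_stabilizerSubgroup]
  exact Subtype.ext_iff

/-- Intertwining maps send `K`-fixed vectors to `K`-fixed vectors. [folklore] -/
theorem map_mem_fixedPoints (T : ρ.IntertwiningMap τ) (K : Subgroup G) {v : V}
    (hv : v ∈ ρ.fixedPoints K) : T v ∈ τ.fixedPoints K := by
  rw [mem_fixedPoints] at hv ⊢
  intro g hg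
  rw [← T.isIntertwining, hv g hg]

variable [TopologicalSpace G]

/-- **Intertwining maps preserve smooth vectors**: the stabiliser of `T v` contains the open
stabiliser of `v`. (Bernstein–Zelevinsky 1976, §2.1.) [folklore] -/
theorem IsSmoothVector.map [SeparatelyContinuousMul G] (T : ρ.IntertwiningMap τ) {v : V}
    (hv : ρ.IsSmoothVector v) : τ.IsSmoothVector (T v) :=
  τ.isSmoothVector_of_le hv (stabilizerSubgroup_le_stabilizerSubgroup_map T v)

/-- The image of a smooth representation under a surjective intertwining map is smooth. [folklore] -/
theorem IsSmooth.of_surjective [SeparatelyContinuousMul G] (hρ : ρ.IsSmooth)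
    (T : ρ.IntertwiningMap τ) (hT : Function.Surjective T) : τ.IsSmooth := by
  intro w
  obtain ⟨v, rfl⟩ := hT w
  exact (hρ v).map T

/-- **A subrepresentation of a smooth representation is smooth.** (Bernstein–Zelevinsky 1976,
§2.1.) This is the light (commutative ring, any group topology) home of the statement; the tree
also has the `Field` specialisation
`Literature.NumberTheory.Automorphic.isSmooth_toRepresentation_of_isSmooth`
(`AutomorphicGLnFlathExistsProofs`), which this one is meant to retire. [folklore] -/
theorem IsSmooth.toRepresentation (hρ : ρ.IsSmooth) (N : Subrepresentation ρ) :
    N.toRepresentation.IsSmooth := by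
  intro v
  rw [IsSmoothVector, stabilizerSubgroup_toRepresentation]
  exact hρ v

/-- **A subrepresentation of an admissible representation is admissible** (the inclusion is an
injective intertwining map; `Representation.IsAdmissible.of_injective`).
(Bernstein–Zelevinsky 1976, §2.1; Bushnell–Henniart 2006, §2.1.) [folklore] -/
theorem IsAdmissible.toRepresentation {k : Type*} [Field k] [Module k V] {ρ : Representation k G V}
    (hρ : ρ.IsAdmissible) (N : Subrepresentation ρ) : N.toRepresentation.IsAdmissible :=
  IsAdmissible.of_injective (IsSmooth.toRepresentation hρ.isSmooth N)
    (Literature.RepresentationTheory.FiniteGroups.Subrepresentation.subtypeIntertwiningMap N)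
    (Literature.RepresentationTheory.Semisimple.Subrepresentation.subtypeIntertwiningMap_injective N)
    hρ

end Smooth

/-! ### Naturality of the averaging projector; admissible quotients -/

section Average

open Literature.NumberTheory.Automorphic.SmoothProjector

variable {k G V W : Type*} [Field k] [CharZero k] [Group G] [TopologicalSpace G]
  [IsTopologicalGroup G] [AddCommGroup V] [Module k V] [AddCommGroup W] [Module k W]
  {ρ : Representation k G V} {τ : Representation k G W}

/-- **Naturality of the averaging operator**: for a compact subgroup `H`, a smooth vector `v` and
an intertwining map `T`, `T (e_H v) = e_H (T v)` (compute both averages on the finite-index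
stabiliser of `v` in `H`, which also fixes `T v`). (Bernstein–Zelevinsky 1976, §2.3: `π(e_H)` is
functorial; Casselman 1995, §2.1.) [folklore] -/
theorem map_avg {H : Subgroup G} (hH : IsCompact (H : Set G)) (T : ρ.IntertwiningMap τ) {v : V}
    (hv : ρ.IsSmoothVector v) : T (avg ρ H v) = avg τ H (T v) := by
  haveI := finiteIndex_stabIn hH hv
  haveI : Fintype (H ⧸ stabIn ρ H v) := Fintype.ofFinite _
  have hB : stabIn ρ H v ≤ stabIn τ H (T v) := by
    intro b hb
    exact Subgroup.mem_subgroupOf.2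
      (stabilizerSubgroup_le_stabilizerSubgroup_map T v (Subgroup.mem_subgroupOf.1 hb))
  rw [avg_eq_index_inv_smul_finsum (stabIn ρ H v) le_rfl,
    avg_eq_index_inv_smul_finsum (stabIn ρ H v) hB, finsum_eq_sum_of_fintype,
    finsum_eq_sum_of_fintype, map_smul, map_sum]
  congr 1
  exact Finset.sum_congr rfl fun q _ => T.isIntertwining _ _ (q.out : G) v

/-- **`K`-fixed vectors lift along surjections**: if `T : V → W` is a surjective intertwining
map, `V` is smooth and `K` is a compact subgroup, then every `K`-fixed vector of `W` is the image
of a `K`-fixed vector of `V` (namely of `e_K v` for any preimage `v`). This is the exactness of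
`V ↦ V^K` (Bernstein–Zelevinsky 1976, §2.3; Casselman 1995, §2.1). [folklore] -/
theorem fixedPoints_le_map_of_surjective (hρ : ρ.IsSmooth) (T : ρ.IntertwiningMap τ)
    (hT : Function.Surjective T) {K : Subgroup G} (hK : IsCompact (K : Set G)) :
    τ.fixedPoints K ≤ (ρ.fixedPoints K).map T.toLinearMap := by
  intro w hw
  obtain ⟨v, rfl⟩ := hT w
  refine ⟨avg ρ K v, avg_mem_fixedPoints hK (hρ v), ?_⟩
  rw [IntertwiningMap.toLinearMap_apply, map_avg hK T (hρ v), avg_eq_self_of_mem_fixedPoints hw]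

/-- For a surjective intertwining map from a smooth representation and a compact subgroup `K`,
`W^K` is exactly the image of `V^K`. [folklore] -/
theorem map_fixedPoints_eq_of_surjective (hρ : ρ.IsSmooth) (T : ρ.IntertwiningMap τ)
    (hT : Function.Surjective T) {K : Subgroup G} (hK : IsCompact (K : Set G)) :
    (ρ.fixedPoints K).map T.toLinearMap = τ.fixedPoints K := by
  refine le_antisymm ?_ (fixedPoints_le_map_of_surjective hρ T hT hK)
  rintro _ ⟨v, hv, rfl⟩
  exact map_mem_fixedPoints T K hv

/-- **Quotients (surjective images) of admissible representations are admissible**: `W` is smooth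
as the image of a smooth representation, and `W^K = T(V^K)` is finitely generated for every
compact open `K`. (Bernstein–Zelevinsky 1976, §2.1 and Prop. 2.3; Bushnell–Henniart 2006, §2.1.)
[folklore] -/
theorem IsAdmissible.of_surjective (hρ : ρ.IsAdmissible) (T : ρ.IntertwiningMap τ)
    (hT : Function.Surjective T) : τ.IsAdmissible := by
  refine ⟨hρ.isSmooth.of_surjective T hT, fun K hK => ?_⟩
  haveI := hρ.2 K hK
  rw [← map_fixedPoints_eq_of_surjective hρ.isSmooth T hT hK]
  exact Module.Finite.map _ _

/-- **The quotient of an admissible representation by a subrepresentation is admissible.**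
(Bernstein–Zelevinsky 1976, §2.1; Bushnell–Henniart 2006, §2.1.) [folklore] -/
theorem IsAdmissible.quotientRep (hρ : ρ.IsAdmissible) (N : Subrepresentation ρ) :
    N.quotientRep.IsAdmissible :=
  hρ.of_surjective N.mkQ N.mkQ_surjective

end Average

/-! ### The `k[G]`-module dictionary: exact sequences, finite length, irreducible quotients -/

section Dictionary

variable {k G V W U : Type*} [CommRing k] [Group G]
  [AddCommGroup V] [Module k V] [AddCommGroup W] [Module k W] [AddCommGroup U] [Module k U]
  {ρ : Representation k G V} {σ : Representation k G W} {τ : Representation k G U}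

/-- The `k[G]`-linear map underlying an intertwining map (Mathlib
`IntertwiningMap.equivLinearMapAsModule`) is the same function. [folklore] -/
@[simp] theorem equivLinearMapAsModule_apply (f : ρ.IntertwiningMap σ) (v : ρ.asModule) :
    IntertwiningMap.equivLinearMapAsModule ρ σ f v = σ.asModuleEquiv.symm (f (ρ.asModuleEquiv v)) :=
  rfl

/-- **Finite length of the middle term of an exact sequence**: if `f : ρ → σ` and `g : σ → τ` are
intertwining maps with `range f = ker g` and the `k[G]`-modules of `ρ` and `τ` have finite length,
so does that of `σ` (Noetherian and Artinian modules are closed under extensions, Mathlib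
`isNoetherian_of_range_eq_ker`, `isArtinian_of_range_eq_ker`). [folklore] -/
theorem isFiniteLength_of_range_eq_ker (f : ρ.IntertwiningMap σ) (g : σ.IntertwiningMap τ)
    (hfg : f.range = g.ker) (hρ : IsFiniteLength k[G] ρ.asModule)
    (hτ : IsFiniteLength k[G] τ.asModule) : IsFiniteLength k[G] σ.asModule := by
  rw [isFiniteLength_iff_isNoetherian_isArtinian] at hρ hτ ⊢
  obtain ⟨_, _⟩ := hρ
  obtain ⟨_, _⟩ := hτ
  set f' := IntertwiningMap.equivLinearMapAsModule ρ σ f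
  set g' := IntertwiningMap.equivLinearMapAsModule σ τ g
  have h : LinearMap.range f' = LinearMap.ker g' := by
    ext w
    simp only [LinearMap.mem_range, LinearMap.mem_ker]
    have hw := SetLike.ext_iff.1 hfg (σ.asModuleEquiv w)
    rw [IntertwiningMap.mem_range, IntertwiningMap.mem_ker] at hw
    constructor
    · rintro ⟨v, rfl⟩
      change τ.asModuleEquiv.symm
        (g (σ.asModuleEquiv (σ.asModuleEquiv.symm (f (ρ.asModuleEquiv v))))) = 0
      rw [LinearEquiv.apply_symm_apply, map_eq_zero_iff _ τ.asModuleEquiv.symm.injective]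
      exact (SetLike.ext_iff.1 hfg (f (ρ.asModuleEquiv v))).1 ⟨ρ.asModuleEquiv v, rfl⟩
    · intro hw0
      change τ.asModuleEquiv.symm (g (σ.asModuleEquiv w)) = 0 at hw0
      rw [map_eq_zero_iff _ τ.asModuleEquiv.symm.injective] at hw0
      obtain ⟨v, hv⟩ := hw.2 hw0
      refine ⟨ρ.asModuleEquiv.symm v, ?_⟩
      change σ.asModuleEquiv.symm (f (ρ.asModuleEquiv (ρ.asModuleEquiv.symm v))) = w
      rw [LinearEquiv.apply_symm_apply, hv, LinearEquiv.symm_apply_apply]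
  exact ⟨isNoetherian_of_range_eq_ker f' g' h, isArtinian_of_range_eq_ker f' g' h⟩

/-- Finite length passes to representations embedded by an injective intertwining map. [folklore] -/
theorem IsFiniteLength.of_injective_intertwiningMap (f : ρ.IntertwiningMap σ)
    (hf : Function.Injective f) (hσ : IsFiniteLength k[G] σ.asModule) :
    IsFiniteLength k[G] ρ.asModule :=
  hσ.of_injective (f := IntertwiningMap.equivLinearMapAsModule ρ σ f) fun v w hvw =>
    ρ.asModuleEquiv.injective (hf (by simpa using hvw))

/-- Finite length passes to images of surjective intertwining maps. [folklore] -/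
theorem IsFiniteLength.of_surjective_intertwiningMap (f : ρ.IntertwiningMap σ)
    (hf : Function.Surjective f) (hρ : IsFiniteLength k[G] ρ.asModule) :
    IsFiniteLength k[G] σ.asModule :=
  hρ.of_surjective (f := IntertwiningMap.equivLinearMapAsModule ρ σ f) fun w => by
    obtain ⟨v, hv⟩ := hf (σ.asModuleEquiv w)
    exact ⟨ρ.asModuleEquiv.symm v, by simp [hv]⟩

/-- The `k[G]`-module of the quotient representation `V ⧸ N` is the quotient of `ρ.asModule` by the
`k[G]`-submodule `N` (as the cokernel of the `k[G]`-linear quotient map, Mathlib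
`LinearMap.quotKerEquivOfSurjective`). [folklore] -/
def quotientRepAsModuleEquiv (N : Subrepresentation ρ) :
    (ρ.asModule ⧸ N.asSubmodule) ≃ₗ[k[G]] N.quotientRep.asModule :=
  (Submodule.quotEquivOfEq _ _ (by
    ext v
    simp only [LinearMap.mem_ker, equivLinearMapAsModule_apply,
      map_eq_zero_iff _ N.quotientRep.asModuleEquiv.symm.injective]
    exact (N.mkQ_eq_zero_iff (ρ.asModuleEquiv v)).symm)).trans
  (LinearMap.quotKerEquivOfSurjective (IntertwiningMap.equivLinearMapAsModule ρ _ N.mkQ)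
    fun w => by
      obtain ⟨v, hv⟩ := N.mkQ_surjective (N.quotientRep.asModuleEquiv w)
      exact ⟨ρ.asModuleEquiv.symm v, by simp [hv]⟩)

end Dictionary

section SubQuotient

open Literature.RepresentationTheory.FiniteGroups Literature.RepresentationTheory.Semisimple

variable {k G V : Type*} [Field k] [Group G] [AddCommGroup V] [Module k V]
  {ρ : Representation k G V}

/-- The inclusion of a subrepresentation (the tree's
`Literature.RepresentationTheory.FiniteGroups.Subrepresentation.subtypeIntertwiningMap`) has range
`N` and the quotient map has kernel `N`: `range (N ↪ V) = ker (V ↠ V ⧸ N)`. [folklore] -/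
theorem range_subtypeIntertwiningMap_eq_ker_mkQ (N : Subrepresentation ρ) :
    (Subrepresentation.subtypeIntertwiningMap N).range = N.mkQ.ker := by
  ext v
  change v ∈ (Subrepresentation.subtypeIntertwiningMap N).range ↔ v ∈ N.mkQ.ker
  rw [IntertwiningMap.mem_range, IntertwiningMap.mem_ker, Subrepresentation.mkQ_eq_zero_iff]
  constructor
  · rintro ⟨w, rfl⟩
    exact w.2
  · intro hv
    exact ⟨⟨v, hv⟩, rfl⟩

/-- **Finite length is an extension-closed property of representations**: if the subrepresentation
`N` and the quotient `V ⧸ N` have finite length over `k[G]`, so does `V`. [folklore] -/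
theorem isFiniteLength_of_subrepresentation (N : Subrepresentation ρ)
    (hN : IsFiniteLength k[G] N.toRepresentation.asModule)
    (hQ : IsFiniteLength k[G] N.quotientRep.asModule) : IsFiniteLength k[G] ρ.asModule :=
  isFiniteLength_of_range_eq_ker _ _ (range_subtypeIntertwiningMap_eq_ker_mkQ N) hN hQ

end SubQuotient

section Irreducible

variable {k G V : Type*} [Field k] [Group G] [AddCommGroup V] [Module k V]
  {ρ : Representation k G V}

/-- **The quotient by `N` is irreducible when `ρ.asModule ⧸ N` is a simple `k[G]`-module**
(equivalently, `N` is a coatom; `Subrepresentation.isIrreducible_quotientRep`). [folklore] -/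
theorem _root_.Subrepresentation.isIrreducible_quotientRep_of_isSimpleModule
    (N : Subrepresentation ρ) [IsSimpleModule k[G] (ρ.asModule ⧸ N.asSubmodule)] :
    N.quotientRep.IsIrreducible := by
  refine Subrepresentation.isIrreducible_quotientRep ?_
  rw [← OrderIso.isCoatom_iff (Subrepresentation.subrepresentationSubmoduleOrderIso (ρ := ρ))]
  exact isSimpleModule_iff_isCoatom.1 ‹_›

end Irreducible

end Representation
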